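import Mathlib
import Literature.NumberTheory.EllipticCurves.BurungaleCastellaGrossiSkinner2026.RefinedKolyvaginConjecture
import Literature.NumberTheory.EllipticCurves.HeegnerPointsKolyvaginTorsionProofs
import Literature.NumberTheory.EllipticCurves.HeegnerPointsKolyvaginPrimitivity
import Literature.NumberTheory.EllipticCurves.HeegnerPointsKolyvaginModPRigidity
import Literature.NumberTheory.EllipticCurves.Jetchev2008.CoreVertices
import HarnessLib

/-!
# HeegnerPointsKolyvaginDivisibilityIndexManin

Topic `Literature/NumberTheory/EllipticCurves`. Named literature fact(s) relocated by the gate from `Summits/BirchSwinnertonDyer/BirchSwinnertonDyer/Theorems/KolyvaginDepthDoorKNSupplyManinFrame.lean`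
(accept-time relocation of `[cite]`d propositions written inline in a Summits proposal; human ruling 2026-08-15).
Sources: BurungaleEtAl2026, CastellaSano2026, Howard2004, Jetchev2008, WZhang2014, Zanarella2019.

* `Literature.NumberTheory.EllipticCurves.CastellaSano2026_kolyvaginClass_selmerDivisibility_eq_padicValNat_tamagawaProduct`
* `Literature.NumberTheory.EllipticCurves.Zanarella2019_kolyvaginClass_one_ne_zero_of_not_selmerDivisible`
-/

namespace Literature.NumberTheory.EllipticCurves

open scoped Classical
open Literature.NumberTheory.EllipticCurves Literature.NumberTheory.EllipticCurves.ModularForms WeierstrassCurve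

/-- **Castella–Sano 2026, Theorem 3 (W. Zhang's refined divisibility-index formula `𝓜_∞(κ^Heeg) = ord_p(Tam_E)`
for `p` split in `K`, under (sur) and (manin) `p ∤ c_φ` — NO `p`-optimality of the parametrisation)**
(F. Castella, T. Sano, arXiv:2601.14504 (2026), title in the bib entry `CastellaSano2026`; a THEOREM of the
source — the split case of W. Zhang's 2014 refinement of Kolyvagin's question, proved there). Verbatim (held text `paper:arxiv-2601.14504`, chunk locators):
§1.1.6, **Theorem 3** [p0005 L39–L47]: *"Let `p>3` be a prime such that (sur) [TeX label `eq:irred`,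
display §1.1.1 p0003 L12–L16: «`ρ̄ : G_ℚ → Aut_{𝔽_p}(E[p])` is surjective»] and (manin) [p0003
L33–L45: «Fix a modular parametrization `φ : X₀(N) → E` and let `c_φ ∈ ℤ` be the associated Manin
constant, so that `φ^*(ω_E) = c_φ·2πi f(z)dz`. Assume that `p ∤ c_φ`»] both hold. If `E` has good
ordinary reduction at `p` and is unramified in `K`, then the following are equivalent: (i)
`𝓜_∞(κ^Heeg) = ord_p(Tam_E)`. (ii) The anticyclotomic Iwasawa Main Conj. (HPMC-det) holds. In
particular, if `p` splits in `K`, then [their Conj. 3: `𝓜_∞(κ^Heeg) = ord_p(Tam_E)`] holds."* (only the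
last sentence — the SPLIT case, an unconditional theorem of the source — is typed here) Setting
(§1.1.5, p0004 L67 – p0005 L8): *"let `E/ℚ` be an elliptic curve of conductor `N`, and let `K`
satisfying the Heegner hypothesis: (Heeg) every prime `ℓ ∣ N` splits in `K`, and with discriminant
`−D_K < 0` such that (disc) `D_K` is odd and `D_K ≠ 3`. Let `p` be an odd prime such that (sur) and
(manin) holds. … `𝓛_Heeg := {ℓ : ℓ is inert in K, ℓ ∤ N, and a_ℓ ≡ ℓ+1 ≡ 0 (mod p)}` … `𝒩_Heeg` …
all squarefree products … `I_ℓ := (ℓ+1, a_ℓ)ℤ_p ∩ ℤ`, … `I_n = Σ_{ℓ∣n} I_ℓ` if `n > 1` … from the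
Kummer images of Heegner points on `E` of conductor `n` associated to a fixed modular parametrization
`φ : X₀(N) → E`, the Kolyvagin derivative process yields … classes `κ^Heeg = {κ_n^Heeg ∈ H¹(K, T/I_nT) :
n ∈ 𝒩_Heeg}`. The classes `κ_n^Heeg` land in the `n`-transverse Selmer group `H¹_{𝓕(n)}(K, T/I_nT)`
(see [Howard] and §3.1) and setting `𝓜(n)` to be `∞` if `κ_n^Heeg = 0` and the maximum `𝓜 ≥ 0` such
that `κ_n^Heeg ∈ p^𝓜 H¹_{𝓕(n)}(K, T/I_nT)` otherwise, one defines `𝓜_r := min{𝓜(n) : ν(n) = r}`. In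
this case, Kolyvagin showed `𝓜_r ≥ 𝓜_{r+1}` for all `r ≥ 0`, and we put `𝓜_∞(κ^Heeg) := lim_r 𝓜_r`"*;
`Tam_E := ∏_{ℓ∣N} c_ℓ` (§1.1.2, p0003 L86–L92); §3.1 [p0012 L5–L46]: `𝓕` = the Selmer structure
propagated from the finite/Kummer conditions, `𝓕(n)` transverse at `v ∣ ℓ ∣ n` (`H¹_tr(K_v, T/I_nT) =
H¹(K_v[ℓ]/K_v, H⁰(K_v[ℓ], T/I_nT))`), (ord) good ordinary at `p`, (unr) `p` unramified in `K`.
TRANSCRIPTION (the vocabulary and conventions of the BCGS Thm. 2 record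
`BurungaleEtAl2026.thm2_kolyvaginClass_divisibility_eq_padicValNat_tamagawaProduct`, whose classes,
Kolyvagin primes, `M(n)`, `Tam_E` and `(≥) ∧ (≤)` reading of `𝓜_∞ = t` through the printed
monotonicity `𝓜_r ≥ 𝓜_{r+1}` are reused VERBATIM, with two changes): (1) the `p`-optimality binder
`Dt.IsPOptimal p` is REPLACED by (manin) `¬ p ∣ Dt.c` (`Dt.c` = the Manin constant of the datum:
`φ^*ω = c · 2πi f dz`, `ModularParametrizationData.smul_periodLattice_le`); (2) divisibility of
`κ_n = c_{M(n)}(n) = d.kolyvaginClass _ M(n)` is taken INSIDE the modified Selmer module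
`H¹_{𝓕(n)}(K, E[p^{M(n)}])` = `Jetchev2008.modifiedSelmerGroup W K ι (p^{M(n)}) n` (Kummer conditions
off `n`, transverse — kernel of restriction to the completions of the ring class field `K[ℓ]` above
`ℓ`, Jetchev §3.1.2 — at `ℓ ∣ n`; for `p`-power coefficients this kernel equals the kernel of
restriction to the maximal `p`-subextension `K_v[ℓ]`, the source's `H¹_tr`, the degree
`[K[ℓ]_λ : K_v[ℓ]]` being prime to `p`). Other binders: `W/ℚ` globally minimal, `3 < p` good ordinary,
(sur) `W.HasSurjectiveModNGaloisRep p`; `K` imaginary quadratic, (Heeg) for `N = W.conductorNorm ℤ`,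
(disc) `Odd d_K ∧ d_K ≠ −3`, `p` split in `K` (`SatisfiesHeegnerHypothesis p K`, hence (unr)), and —
ADDED, weaker than print — `E(K)[p] = 0` and `p ∤ d_K`; the source's `κ_n^Heeg` is Howard's class,
which differs from McCallum's `c_{M(n)}(n)` by the automorphism `χ_n` of Howard's Thm. 1.7.5 (a unit
scalar of `ℤ/p^{M(n)}` under (sur)) and the `⊗ G_n`-twist, neither of which changes divisibility in
`H¹_{𝓕(n)}`; ring class fields number fields (instance binder, as in `Jetchev2008.CoreVertices`).
CONCLUSION, `t = padicValNat p W.tamagawaProduct`: (≥) every `c_{M(n)}(n)`, `n ∈ 𝒩_Heeg ∖ {1}`, is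
`p^t · ξ` for some `ξ ∈ H¹_{𝓕(n)}(K, E[p^{M(n)}])`, AND (≤) some `c_{M(n)}(n)`, `n ≠ 1`, is not
`p^{t+1} · ξ` for any such `ξ`. Weaker than print where it differs, never stronger. Size XL (the
`Λ^ac`-adic Heegner Kolyvagin system, the determinantal Perrin-Riou main-conj. formalism, Howard's
divisibility, BDP/Castella–Hsieh in the split case, Skinner–Urban); no `_holds` expected; nothing is
asserted — users take `(h : CastellaSano2026_kolyvaginClass_selmerDivisibility_eq_padicValNat_tamagawaProduct)`.
-- TODO(general form): the inert case ((i) ⟺ (ii) with (HPMC-det) as hypothesis); the Kurihara half (Thms. 1–2) of the paper.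
[cite: CastellaSano2026, Thm. 3 (§1.1.6, arXiv:2601.14504 held text p0005 L39–L47) with §1.1.1 (sur) (p0003 L10–L16), §1.1.2 Tam_E (p0003 L86–L92), §1.1.5 (Heeg)/(disc)/(manin)/𝓛_Heeg/I_ℓ/κ_n^Heeg/𝓜(n)/𝓜_r/𝓜_∞ (p0003 L33–L45, p0004 L67 – p0005 L33), §3.1 (p0012 L1–L46), §3.4 (p0015 L105 ff.)]
[cite: Howard2004, Def. 1.2.2 (𝓕(n)), Thm. 1.7.5 (κ'_n = χ_n^{−1} κ_n ⊗ σ)]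
[cite: Jetchev2008, §3.1.2 and §3.4.1 (H¹_tr and H¹_{𝓕(c)}, pp. 814–816)]
[cite: BurungaleEtAl2026, Thm. 2 (the p-optimal twin; arXiv:2312.09301 §0.1)]
[file NumberTheory/EllipticCurves/HeegnerPointsKolyvaginDivisibilityIndexManin] -/
def CastellaSano2026_kolyvaginClass_selmerDivisibility_eq_padicValNat_tamagawaProduct : Prop :=
  ∀ (W : WeierstrassCurve ℚ) [W.IsElliptic] [W.IsGloballyMinimal] (p : ℕ) [hp : Fact p.Prime],
    3 < p → W.HasGoodReductionAtPrime p → ¬ (p : ℤ) ∣ W.frobeniusTrace p →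
    W.HasSurjectiveModNGaloisRep p →
    ∀ (K : Type) [Field K] [NumberField K], IsImaginaryQuadratic K →
      ∀ [NeZero (W.conductorNorm ℤ)], SatisfiesHeegnerHypothesis (W.conductorNorm ℤ) K →
      Odd (NumberField.discr K) → NumberField.discr K ≠ -3 → ¬ ((p : ℤ) ∣ NumberField.discr K) →
      AddSubgroup.torsionBy (W.baseChange K).toAffine.Point (p : ℤ) = ⊥ →
      SatisfiesHeegnerHypothesis p K →
      ∀ (Dt : ModularParametrizationData W (W.conductorNorm ℤ)), ¬ ((p : ℤ) ∣ Dt.c) →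
      ∀ (β : ℤ), (4 * (W.conductorNorm ℤ : ℤ)) ∣ β ^ 2 - NumberField.discr K →
      ∀ (ι : K →+* ℂ) [∀ k : ℕ, NumberField (ringClassField K ι k)],
        (∀ (n : ℕ) (d : KolyvaginHeegnerData Dt β ι n) (M : ℕ), n ≠ 1 →
            KolyvaginDescent.KolSupp (Zhang2014.IsKolyvaginPrime (W.conductorNorm ℤ) W K p) n →
            (M : ℕ∞) = Zhang2014.levelIndex W p n →
            ∃ ξ ∈ Jetchev2008.modifiedSelmerGroup W K ι ((p ^ M : ℕ) : ℤ) n,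
              ((p ^ padicValNat p W.tamagawaProduct : ℕ) : ℤ) • ξ = d.kolyvaginClass hp.out M) ∧
        (∃ (n : ℕ) (d : KolyvaginHeegnerData Dt β ι n) (M : ℕ), n ≠ 1 ∧
            KolyvaginDescent.KolSupp (Zhang2014.IsKolyvaginPrime (W.conductorNorm ℤ) W K p) n ∧
            (M : ℕ∞) = Zhang2014.levelIndex W p n ∧
            ¬ ∃ ξ ∈ Jetchev2008.modifiedSelmerGroup W K ι ((p ^ M : ℕ) : ℤ) n,
              ((p ^ (padicValNat p W.tamagawaProduct + 1) : ℕ) : ℤ) • ξ = d.kolyvaginClass hp.out M)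

/-- **Zanarella 2019 — a class not divisible by `p` INSIDE ITS SELMER MODULE makes the mod-`p`
Heegner-point Kolyvagin system non-zero** (M. C. Zanarella, arXiv:1908.09197 (2019), Def. 2.17 and
Prop. 2.18; a THEOREM-level remark of the source). Verbatim (held text `paper:arxiv-1908.09197`):
Def. 2.17 [p0011 L19–L26], for `R` a DVR, `κ ∈ KS(T, 𝓕, 𝓛)`, `κ^{(k)}` its image as a Kolyvagin
system for `(T/𝔪^kT, 𝓕, 𝓛^{(k)})` and `H^{(k)}(n) = H¹_{𝓕(n)}(K, T/𝔪^kT)` (the MODIFIED SELMER MODULE,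
§2.1 p0007 L40–L46: `𝓗(n)` with `𝓕(n)` transverse on the divisors of `n`): *"`∂^{(∞)}(κ) := min{max{a
: κ_n^{(k)} ∈ 𝔪^a H^{(k)}(n)} : n ∈ 𝒩^{(k)}}`. We call `κ` primitive if `∂^{(∞)}(κ) = 0`."*; Prop.
2.18, proof [p0011 L40]: *"We note that `∂^{(∞)}(κ) = 0` is the same as `κ^{(1)} ≠ 0`."*; Rem. 2.20 +
§3.1: the triple `(T_pE, 𝓕_BK, 𝓛_1(T_pE))` with the finite-level Kolyvagin system of the Heegner points
(setting `D_K < −4`, `(N_E, D_K) = 1`, (Heeg), (good), `p ≥ 5`, (res-surj), `p ∤ N_E D_K`). HENCE: if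
for some `n ∈ 𝒩^{(M(n))}`, `n ≠ 1`, the class `κ_n = κ_n^{(M(n))}` is not in `𝔪·H^{(M(n))}(n) =
p·H¹_{𝓕(n)}(K, E[p^{M(n)}])`, then the term `(k, n) = (M(n), n)` of `∂^{(∞)}` vanishes, so `κ^{(1)} ≠ 0`:
some `c_1(n') ≠ 0`. This is the record `Zanarella2019_kolyvaginClass_one_ne_zero_of_not_divisible`
(file `HeegnerPointsKolyvaginPrimitivity`, same transcription, same binders) with its HYPOTHESIS
weakened from «`c_{M(n)}(n) ∉ p·H¹(K, E[p^{M(n)}])`» to the printed «`c_{M(n)}(n) ∉ p·H¹_{𝓕(n)}(K,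
E[p^{M(n)}])`», the Selmer module being `Jetchev2008.modifiedSelmerGroup W K ι (p^{M(n)}) n` (Kummer
conditions off `n`, transverse at `ℓ ∣ n`; ring class fields number fields as an instance binder).
Weaker than print where it differs (the conclusion drops `κ̄_{n'} ∈ H¹_{BK(n')}`; surjectivity,
ordinarity carried as in the sibling), never stronger. Size L; no `_holds` here.
[cite: Zanarella2019, Def. 2.17, Prop. 2.18 (proof, first sentence), Rem. 2.20, §2.1 (𝓗(n)), §3.1 (arXiv:1908.09197 held text p0007 L34–L46, p0011 L19–L51, p0014 L1–L70)]
[cite: Howard2004, Def. 1.2.2 (𝓕(n))] [cite: Jetchev2008, §3.4.1 (H¹_{𝓕(c)})]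
[cite: WZhang2014, Notations (xii) (M(ℓ), Λ, c_M(n))]
[file NumberTheory/EllipticCurves/HeegnerPointsKolyvaginPrimitivity] -/
def Zanarella2019_kolyvaginClass_one_ne_zero_of_not_selmerDivisible : Prop :=
  ∀ (W : WeierstrassCurve ℚ) [W.IsElliptic] [W.IsGloballyMinimal] (p : ℕ) [hp : Fact p.Prime],
    5 ≤ p → W.HasGoodReductionAtPrime p → ¬ (p : ℤ) ∣ W.frobeniusTrace p →
    W.HasSurjectiveModNGaloisRep p →
    ∀ (K : Type) [Field K] [NumberField K], IsImaginaryQuadratic K → NumberField.discr K < -4 →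
      ¬ ((p : ℤ) ∣ NumberField.discr K) →
      IsCoprime (NumberField.discr K) ((W.conductorNorm ℤ : ℕ) : ℤ) →
      ∀ [NeZero (W.conductorNorm ℤ)], SatisfiesHeegnerHypothesis (W.conductorNorm ℤ) K →
      ∀ (Dt : ModularParametrizationData W (W.conductorNorm ℤ)) (β : ℤ) (ι : K →+* ℂ)
        [∀ k : ℕ, NumberField (ringClassField K ι k)]
        (n : ℕ) (d : KolyvaginHeegnerData Dt β ι n) (M : ℕ), n ≠ 1 →
        KolyvaginDescent.KolSupp (Zhang2014.IsKolyvaginPrime (W.conductorNorm ℤ) W K p) n →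
        (M : ℕ∞) = Zhang2014.levelIndex W p n →
        (¬ ∃ ξ ∈ Jetchev2008.modifiedSelmerGroup W K ι ((p ^ M : ℕ) : ℤ) n,
            (p : ℤ) • ξ = d.kolyvaginClass hp.out M) →
        ∃ (n' : ℕ) (d' : KolyvaginHeegnerData Dt β ι n'),
          KolyvaginDescent.KolSupp (Zhang2014.IsKolyvaginPrime (W.conductorNorm ℤ) W K p) n' ∧
            d'.kolyvaginClass hp.out 1 ≠ 0

end Literature.NumberTheory.EllipticCurves
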